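import Mathlib
import Literature.Probability.Percolation.PercolationProofs
import Literature.Probability.LatticeModels.ProdBernoulliIndependence
import Literature.Probability.LatticeModels.ProdBernoulliClusterLocality
import Literature.Probability.Percolation.ConditionalPositiveAssociation
import Literature.Probability.Percolation.TwoClusterConditionalAssociation
import HarnessLib

/-!
# Crux `PercNearOneGluing.AdditiveGluing` (stmt-CriticalPhenomena-4576), line `sigma-recursion-lemma5-any-relay` — stub `stub_defectTwoRelays`

Helper file for the crux (lead prover-line-stmt-CriticalPhenomena-4576-0): proves exactly the
registered stub signature `stub_defectTwoRelays` (the gluing defect with TWO relays); lands with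
`--supports stmt-CriticalPhenomena-4576`.

## Content

Weighted complete graph on `Fin n`, law `G = prodBernoulli w` on `BondConfig (Fin n)`; the block
`S` is contracted by `glue w S` (weight `1` on the non-loop pairs `D_S` inside `S`), law `K`.
Three inputs are DISPLAYED HYPOTHESES of the statement (they are neighbouring stubs of the line):
Kozma–Nitzan Lemma 3(ii) (arXiv:2401.12397, p. 6) in denominator-free form (`hL3ii`), the glue
pushforward `K(E) = G{ω | ω ∪ D_S ∈ E}` (`hpush`) and glued reachability
`ω ∪ D_S ∈ {x ↔ y} ↔ ω ∈ {x ↔ y} ∨ (ω ∈ {x ↔ S} ∧ ω ∈ {S ↔ y})` (`hreach`).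
Claim: if `G(a ↔ b) ≤ G(a₁ ↔ b)` then `K(S ↔ {a, a₁}) − K(S ↔ b) ≤ 1 − K(a ↔ b)`.

## Proof

Write `{S ↔ x} = {∃ s ∈ S, s ↔ x}` and `Q = {a ↮ S} = {∀ s ∈ S, ¬ a ↔ s}` (the helper lemmas
take these events as abstract sets `Ea, Ea₁, Eb, Q` characterised by their membership).
* Transfer (`stub_defectTwoRelays`): by `hpush` the three `K`-probabilities are
  `G`-probabilities of pulled-back events `X, Y, T`, and by `hreach` these satisfy
  `X ⊆ {S ↔ a} ∪ {S ↔ a₁}`, `{S ↔ b} ⊆ Y`, `T ⊆ {a ↔ b} ∪ (Qᶜ ∩ {S ↔ b})`.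
* Measure algebra in `G` (`defectTwo_keyG`): `G(X) − G(Y) ≤ G(X \ Y)`,
  `X \ Y ⊆ (Qᶜ \ {S↔b}) ∪ L` with `L = ({S ↔ a₁} ∩ Q) \ {S ↔ b}`, and the two disjoint pieces
  `Qᶜ \ {S ↔ b}` and `Q \ {a ↔ b}` lie in `Tᶜ`; so it suffices that (★) `G(L) ≤ G(Q \ {a↔b})`.
* (★) (`defectTwo_starG`): with `D'' = Q \ {a ↔ a₁}` one has `L ⊆ D'' \ {a₁ ↔ b}` and
  `G(D'' \ {a₁↔b}) = G(D'') − G(D'' ∩ {a₁↔b}) ≤ G(D'') − G(D'' ∩ {a↔b}) = G(D'' \ {a↔b})`, by the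
  comparison (H'') `G(D'' ∩ {a↔b}) ≤ G(D'' ∩ {a₁↔b})`.
* (H'') (`defectTwo_cancel`): KN Lemma 3(ii) with the decreasing, `C_a`-determined event `Q`
  (`defectTwo_Q_closed`, via `reachable_iff_exists_mem_openEdgeCluster`) and `d = 0` gives
  `G({a↔b} ∩ Q) ≤ G({a₁↔b} ∩ Q)`; on `{a ↔ a₁}` the two events coincide, cancel that part.
-/

namespace Summit.CriticalPhenomena.PercolationContinuityZ3.Theorems

open MeasureTheory Set
open Literature.Probability.LatticeModels (prodBernoulli)
open Literature.Probability.Percolation (BondConfig openConn openGraph openEdgeCluster)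

noncomputable section
open Classical

section DefectTwoRelaysAux

variable {n : ℕ}

/-- The event `Q = {a ↮ S}` ("`a` is joined to no vertex of `S`") is decreasing and determined
by the open edge cluster of `a` in the sense of Kozma–Nitzan Lemma 3(ii): if `ω' ∈ Q` and
`C_a(ω) ⊆ C_a(ω')` then `ω ∈ Q` (an open path from `a` to `s ≠ a` ends with an edge of `C_a`).
[folklore] -/
theorem defectTwo_Q_closed (S : Finset (Fin n)) (a : Fin n) {Q : Set (BondConfig (Fin n))}
    (hQ : ∀ ω, ω ∈ Q ↔ ∀ s ∈ S, ω ∉ (openConn a s : Set (BondConfig (Fin n)))) :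
    ∀ ω ω' : BondConfig (Fin n), ω' ∈ Q →
      openEdgeCluster ω a ⊆ openEdgeCluster ω' a → ω ∈ Q := by
  intro ω ω' hω' hsub
  refine (hQ ω).2 fun s hs hωs => (hQ ω').1 hω' s hs ?_
  rcases (Literature.Probability.Percolation.reachable_iff_exists_mem_openEdgeCluster ω a s).1
      hωs with rfl | ⟨e, he, hse⟩
  · exact SimpleGraph.Reachable.refl _
  · exact (Literature.Probability.Percolation.reachable_iff_exists_mem_openEdgeCluster ω' a s).2
      (Or.inr ⟨e, hsub he, hse⟩)

/-- **(H'') — cancelling the common part on `{a ↔ a₁}`.**  If `μ({a↔b} ∩ Q) ≤ μ({a₁↔b} ∩ Q)`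
then the same holds with `Q` replaced by `Q \ {a ↔ a₁}`, because on `{a ↔ a₁}` the events
`{a ↔ b}` and `{a₁ ↔ b}` coincide. [cite: KozmaNitzan2024, Lemma 3 (proof, pp. 6–7)] -/
theorem defectTwo_cancel (μ : Measure (BondConfig (Fin n))) [IsFiniteMeasure μ]
    (Q : Set (BondConfig (Fin n))) (a a₁ b : Fin n)
    (hH : μ.real (openConn a b ∩ Q) ≤ μ.real (openConn a₁ b ∩ Q)) :
    μ.real ((Q \ openConn a a₁) ∩ openConn a b) ≤
      μ.real ((Q \ openConn a a₁) ∩ openConn a₁ b) := by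
  have hCm : MeasurableSet (openConn a a₁ : Set (BondConfig (Fin n))) := MeasurableSet.of_discrete
  have h1 := measureReal_inter_add_sdiff (μ := μ) (s := openConn a b ∩ Q) hCm
  have h2 := measureReal_inter_add_sdiff (μ := μ) (s := openConn a₁ b ∩ Q) hCm
  have heq : (openConn a b ∩ Q) ∩ openConn a a₁ =
      ((openConn a₁ b ∩ Q) ∩ openConn a a₁ : Set (BondConfig (Fin n))) := by
    ext ω
    simp only [Set.mem_inter_iff]
    constructor
    · rintro ⟨⟨hab, hq⟩, hc⟩
      exact ⟨⟨SimpleGraph.Reachable.trans (SimpleGraph.Reachable.symm hc) hab, hq⟩, hc⟩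
    · rintro ⟨⟨ha₁b, hq⟩, hc⟩
      exact ⟨⟨SimpleGraph.Reachable.trans hc ha₁b, hq⟩, hc⟩
  have hs1 : (Q \ openConn a a₁) ∩ openConn a b =
      ((openConn a b ∩ Q) \ openConn a a₁ : Set (BondConfig (Fin n))) := by
    ext ω
    simp only [Set.mem_inter_iff, Set.mem_sdiff]
    tauto
  have hs2 : (Q \ openConn a a₁) ∩ openConn a₁ b =
      ((openConn a₁ b ∩ Q) \ openConn a a₁ : Set (BondConfig (Fin n))) := by
    ext ω
    simp only [Set.mem_inter_iff, Set.mem_sdiff]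
    tauto
  rw [hs1, hs2]
  rw [heq] at h1
  linarith

/-- **(★) — the two-relay comparison in the un-glued measure.**  With `Ea₁ = {S ↔ a₁}`,
`Eb = {S ↔ b}`, `Q = {a ↮ S}` and (H'') for `Q`: `μ((Ea₁ ∩ Q) \ Eb) ≤ μ(Q \ {a↔b})`, via
`D'' = Q \ {a↔a₁}`, `(Ea₁ ∩ Q) \ Eb ⊆ D'' \ {a₁↔b}` and
`μ(D'' \ {a₁↔b}) = μ(D'') − μ(D'' ∩ {a₁↔b}) ≤ μ(D'') − μ(D'' ∩ {a↔b}) = μ(D'' \ {a↔b})`.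
[cite: KozmaNitzan2024, §3.2 (Lemma 5 and Thm. 5)] -/
theorem defectTwo_starG (μ : Measure (BondConfig (Fin n))) [IsFiniteMeasure μ]
    (S : Finset (Fin n)) (a a₁ b : Fin n) {Ea₁ Eb Q : Set (BondConfig (Fin n))}
    (hEa₁ : ∀ ω, ω ∈ Ea₁ ↔ ∃ s ∈ S, ω ∈ (openConn s a₁ : Set (BondConfig (Fin n))))
    (hEb : ∀ ω, ω ∈ Eb ↔ ∃ s ∈ S, ω ∈ (openConn s b : Set (BondConfig (Fin n))))
    (hQ : ∀ ω, ω ∈ Q ↔ ∀ s ∈ S, ω ∉ (openConn a s : Set (BondConfig (Fin n))))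
    (hH : μ.real (openConn a b ∩ Q) ≤ μ.real (openConn a₁ b ∩ Q)) :
    μ.real ((Ea₁ ∩ Q) \ Eb) ≤ μ.real (Q \ openConn a b) := by
  have hL : (Ea₁ ∩ Q) \ Eb ⊆ (Q \ openConn a a₁) \ openConn a₁ b := by
    rintro ω ⟨⟨hωE, hq⟩, hωEb⟩
    obtain ⟨s, hs, hsa₁⟩ := (hEa₁ ω).1 hωE
    refine ⟨⟨hq, fun hc => (hQ ω).1 hq s hs ?_⟩, fun h₁b => hωEb ((hEb ω).2 ⟨s, hs, ?_⟩)⟩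
    · exact SimpleGraph.Reachable.trans hc (SimpleGraph.Reachable.symm hsa₁)
    · exact SimpleGraph.Reachable.trans hsa₁ h₁b
  have hm1 := measureReal_inter_add_sdiff (μ := μ) (s := Q \ openConn a a₁)
    (t := openConn a₁ b) MeasurableSet.of_discrete
  have hm2 := measureReal_inter_add_sdiff (μ := μ) (s := Q \ openConn a a₁)
    (t := openConn a b) MeasurableSet.of_discrete
  have hc := defectTwo_cancel μ Q a a₁ b hH
  calc μ.real ((Ea₁ ∩ Q) \ Eb)
      ≤ μ.real ((Q \ openConn a a₁) \ openConn a₁ b) := measureReal_mono hL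
    _ ≤ μ.real ((Q \ openConn a a₁) \ openConn a b) := by linarith
    _ ≤ μ.real (Q \ openConn a b) := measureReal_mono (sdiff_subset_sdiff_left sdiff_subset)

/-- **The gluing defect with two relays, after transfer to the un-glued measure.**  For a
probability measure `μ` on configurations, the events `Ea = {S↔a}`, `Ea₁ = {S↔a₁}`, `Eb = {S↔b}`,
`Q = {a↮S}`, the comparison (H'') `μ({a↔b} ∩ Q) ≤ μ({a₁↔b} ∩ Q)`, and events `X ⊆ Ea ∪ Ea₁`,
`Y ⊇ Eb`, `T ⊆ {a↔b} ∪ (Qᶜ ∩ Eb)`: `μ(X) − μ(Y) ≤ 1 − μ(T)`.  (Measure algebra: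
`μ(X) − μ(Y) ≤ μ(X \ Y)`, `X \ Y ⊆ (Qᶜ \ Eb) ∪ ((Ea₁ ∩ Q) \ Eb)`, (★) for the second piece, and
the two disjoint pieces `Qᶜ \ Eb`, `Q \ {a↔b}` of `Tᶜ`.) [cite: KozmaNitzan2024, §3.2 (Thm. 5)] -/
theorem defectTwo_keyG (μ : Measure (BondConfig (Fin n))) [IsProbabilityMeasure μ]
    (S : Finset (Fin n)) (a a₁ b : Fin n) (Ea Ea₁ Eb Q : Set (BondConfig (Fin n)))
    (hEa : ∀ ω, ω ∈ Ea ↔ ∃ s ∈ S, ω ∈ (openConn s a : Set (BondConfig (Fin n))))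
    (hEa₁ : ∀ ω, ω ∈ Ea₁ ↔ ∃ s ∈ S, ω ∈ (openConn s a₁ : Set (BondConfig (Fin n))))
    (hEb : ∀ ω, ω ∈ Eb ↔ ∃ s ∈ S, ω ∈ (openConn s b : Set (BondConfig (Fin n))))
    (hQ : ∀ ω, ω ∈ Q ↔ ∀ s ∈ S, ω ∉ (openConn a s : Set (BondConfig (Fin n))))
    (hH : μ.real (openConn a b ∩ Q) ≤ μ.real (openConn a₁ b ∩ Q))
    {X Y T : Set (BondConfig (Fin n))}
    (hX : X ⊆ Ea ∪ Ea₁) (hY : Eb ⊆ Y) (hT : T ⊆ openConn a b ∪ (Qᶜ ∩ Eb)) :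
    μ.real X - μ.real Y ≤ 1 - μ.real T := by
  -- (1) `X \ Y ⊆ (Qᶜ \ Eb) ∪ L`
  have hXY : X \ Y ⊆ (Qᶜ \ Eb) ∪ ((Ea₁ ∩ Q) \ Eb) := by
    rintro ω ⟨hωX, hωY⟩
    have hωEb : ω ∉ Eb := fun h => hωY (hY h)
    rcases hX hωX with hωEa | hωEa₁
    · obtain ⟨s, hs, hsa⟩ := (hEa ω).1 hωEa
      exact Or.inl ⟨fun hq => (hQ ω).1 hq s hs (SimpleGraph.Reachable.symm hsa), hωEb⟩
    · by_cases hq : ω ∈ Q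
      · exact Or.inr ⟨⟨hωEa₁, hq⟩, hωEb⟩
      · exact Or.inl ⟨hq, hωEb⟩
  -- (2) the two disjoint pieces of `Tᶜ`
  have hdisj : Disjoint (Qᶜ \ Eb) (Q \ openConn a b) :=
    Set.disjoint_left.2 fun ω h1 h2 => h1.1 h2.1
  have hTc : (Qᶜ \ Eb) ∪ (Q \ openConn a b) ⊆ Tᶜ := by
    rintro ω hω hωT
    rcases hT hωT with hab | ⟨hqc, hωEb⟩
    · rcases hω with ⟨hqc, hωEb⟩ | ⟨_, hab'⟩
      · refine hqc ((hQ ω).2 fun s hs has => hωEb ((hEb ω).2 ⟨s, hs, ?_⟩))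
        exact SimpleGraph.Reachable.trans (SimpleGraph.Reachable.symm has) hab
      · exact hab' hab
    · rcases hω with ⟨_, hωEb'⟩ | ⟨hq, _⟩
      · exact hωEb' hωEb
      · exact hqc hq
  -- (3) assemble
  have hstar := defectTwo_starG μ S a a₁ b hEa₁ hEb hQ hH
  calc μ.real X - μ.real Y ≤ μ.real (X \ Y) := le_measureReal_sdiff
    _ ≤ μ.real ((Qᶜ \ Eb) ∪ ((Ea₁ ∩ Q) \ Eb)) := measureReal_mono hXY
    _ ≤ μ.real (Qᶜ \ Eb) + μ.real ((Ea₁ ∩ Q) \ Eb) := measureReal_union_le _ _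
    _ ≤ μ.real (Qᶜ \ Eb) + μ.real (Q \ openConn a b) := by linarith
    _ = μ.real ((Qᶜ \ Eb) ∪ (Q \ openConn a b)) :=
        (measureReal_union hdisj MeasurableSet.of_discrete).symm
    _ ≤ μ.real Tᶜ := measureReal_mono hTc
    _ = 1 - μ.real T := by rw [measureReal_compl MeasurableSet.of_discrete, probReal_univ]

end DefectTwoRelaysAux

/-- Registered stub `stub_defectTwoRelays` of crux stmt-CriticalPhenomena-4576 (line
sigma-recursion-lemma5-any-relay): the gluing defect with two relays.  With KN Lemma 3(ii), the
glue pushforward and glued reachability displayed as hypotheses: if `P_G(a ↔ b) ≤ P_G(a₁ ↔ b)`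
then in `G/S`, `P(S ↔ {a, a₁}) − P(S ↔ b) ≤ P(a ↮ b)`.  See the module docstring for the proof.
[cite: KozmaNitzan2024, §3.2 (Lemma 5, Thm. 5)] -/
theorem stub_defectTwoRelays :
    ∀ (n : ℕ),
      (∀ (w : Sym2 (Fin n) → unitInterval) (a₁ a₂ b : Fin n) (Q : Set (BondConfig (Fin n)))
        (d : ℝ),
        (∀ ω ω' : BondConfig (Fin n), ω' ∈ Q → openEdgeCluster ω a₁ ⊆ openEdgeCluster ω' a₁ → ω ∈ Q) →
        0 ≤ d →
        (prodBernoulli w).real (openConn a₁ b) ≤ (prodBernoulli w).real (openConn a₂ b) + d →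
        (prodBernoulli w).real (openConn a₁ b ∩ Q) ≤
          (prodBernoulli w).real (openConn a₂ b ∩ Q) + d) →
      (∀ (w : Sym2 (Fin n) → unitInterval) (S : Finset (Fin n)) (E : Set (BondConfig (Fin n))),
        (prodBernoulli (fun e : Sym2 (Fin n) =>
            if (∀ x ∈ e, x ∈ S) ∧ ¬ e.IsDiag then 1 else w e)).real E =
          (prodBernoulli w).real
            {ω | (ω ∪ {e | (∀ x ∈ e, x ∈ S) ∧ ¬ e.IsDiag}) ∈ E}) →
      (∀ (S : Finset (Fin n)) (ω : BondConfig (Fin n)) (x y : Fin n),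
        ((ω ∪ {e | (∀ x ∈ e, x ∈ S) ∧ ¬ e.IsDiag}) ∈ openConn x y ↔
          (ω ∈ openConn x y ∨
            ((∃ s ∈ S, ω ∈ openConn x s) ∧ (∃ s ∈ S, ω ∈ openConn s y))))) →
      ∀ (w : Sym2 (Fin n) → unitInterval) (S : Finset (Fin n)) (a a₁ b : Fin n),
        b ∉ S → a ∉ S → a₁ ∉ S →
        (prodBernoulli w).real (openConn a b) ≤ (prodBernoulli w).real (openConn a₁ b) →
        (prodBernoulli (fun e : Sym2 (Fin n) =>
            if (∀ x ∈ e, x ∈ S) ∧ ¬ e.IsDiag then 1 else w e)).real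
            (⋃ s ∈ S, (openConn s a ∪ openConn s a₁)) -
          (prodBernoulli (fun e : Sym2 (Fin n) =>
            if (∀ x ∈ e, x ∈ S) ∧ ¬ e.IsDiag then 1 else w e)).real (⋃ s ∈ S, openConn s b) ≤
          1 - (prodBernoulli (fun e : Sym2 (Fin n) =>
            if (∀ x ∈ e, x ∈ S) ∧ ¬ e.IsDiag then 1 else w e)).real (openConn a b)
    := by
  intro n hL3ii hpush hreach w S a a₁ b _ _ _ hle
  rw [hpush w S, hpush w S, hpush w S]
  -- (H') = KN Lemma 3(ii) with `Q = {a ↮ S}` and `d = 0`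
  have hH := hL3ii w a a₁ b {ω | ∀ s ∈ S, ω ∉ (openConn a s : Set (BondConfig (Fin n)))} 0
    (defectTwo_Q_closed S a fun _ => Iff.rfl) le_rfl (by rw [add_zero]; exact hle)
  rw [add_zero] at hH
  refine defectTwo_keyG (prodBernoulli w) S a a₁ b
    {ω | ∃ s ∈ S, ω ∈ (openConn s a : Set (BondConfig (Fin n)))}
    {ω | ∃ s ∈ S, ω ∈ (openConn s a₁ : Set (BondConfig (Fin n)))}
    {ω | ∃ s ∈ S, ω ∈ (openConn s b : Set (BondConfig (Fin n)))}
    {ω | ∀ s ∈ S, ω ∉ (openConn a s : Set (BondConfig (Fin n)))}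
    (fun _ => Iff.rfl) (fun _ => Iff.rfl) (fun _ => Iff.rfl) (fun _ => Iff.rfl) hH ?_ ?_ ?_
  · -- `X ⊆ {S ↔ a} ∪ {S ↔ a₁}`
    intro ω hω
    simp only [Set.mem_setOf_eq, Set.mem_iUnion, Set.mem_union, exists_prop] at hω
    obtain ⟨s, hs, h | h⟩ := hω
    · rcases (hreach S ω s a).1 h with h' | ⟨-, s', hs', h'⟩
      · exact Or.inl ⟨s, hs, h'⟩
      · exact Or.inl ⟨s', hs', h'⟩
    · rcases (hreach S ω s a₁).1 h with h' | ⟨-, s', hs', h'⟩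
      · exact Or.inr ⟨s, hs, h'⟩
      · exact Or.inr ⟨s', hs', h'⟩
  · -- `{S ↔ b} ⊆ Y`
    rintro ω ⟨s, hs, h⟩
    simp only [Set.mem_setOf_eq, Set.mem_iUnion, exists_prop]
    exact ⟨s, hs, (hreach S ω s b).2 (Or.inl h)⟩
  · -- `T ⊆ {a ↔ b} ∪ ({a ↔ S} ∩ {S ↔ b})`
    intro ω hω
    rcases (hreach S ω a b).1 hω with h | ⟨⟨s, hs, h1⟩, h2⟩
    · exact Or.inl h
    · exact Or.inr ⟨fun hq => hq s hs h1, h2⟩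

end

end Summit.CriticalPhenomena.PercolationContinuityZ3.Theorems
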